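import Literature.MathematicalPhysics.QuantumFieldTheory.Balaban1983to89.B6InMajorantTransplantL0
import Literature.MathematicalPhysics.QuantumFieldTheory.Balaban1983to89.B6Geom246MultiLevelBoxL0
import Literature.MathematicalPhysics.QuantumFieldTheory.Balaban1983to89.B6Geom246MultiLevelTorusL0
import Literature.MathematicalPhysics.QuantumFieldTheory.Balaban1983to89.B6GlobalChartV1L0
import Literature.MathematicalPhysics.QuantumFieldTheory.Balaban1983to89.B6MultiLevelBoxOperatorL0
import Literature.MathematicalPhysics.QuantumFieldTheory.Balaban1983to89.B6MultiLevelTorusOperatorL0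
import Literature.MathematicalPhysics.QuantumFieldTheory.Balaban1983to89.B6Prop26ReachTransplantL0
import Literature.MathematicalPhysics.QuantumFieldTheory.Balaban1983to89.B6InDecayWindowV1
/-!
# `Balaban1983to89.B6InDecayWindowV1L0` — LEVEL-0 TWIN (programme G-F3′-L0, director-ym LINE №27 / UV3-NODE §24.5; plan `lit-balaban-r03/G-F3L0-PLAN.md`) of `B6InDecayWindowV1`:
the same declarations, SAME NAMES AND STATEMENTS, for nested families WITH print's region `Λ₀ = T ∖ Ω₁` ADMITTED (structures
`B6MultiLevelBoxOperatorL0.Domains` / `B6MultiLevelTorusOperatorL0.TDomains`: levels `0, …, k`, the level-`0` block a single site, `Q′₀ = id`,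
finite weight `a₀` — print p.225 (2.14) «Σ_{j=0}^k … (Q′₀λ)(x) = λ(x), x ∈ Λ₀», p.229 «taking a sequence (2.1) … smallest possible domains B^j(Λ_j),
and considering the operator Δ_a defined by (2.19), (2.20) for this sequence»).  Every `D`-free object is the lineage's, consumed BY NAME; no existing
module is touched; no fact is minted.  Unit `lit-balaban-r03` (B6 fold owner, r03 gen 36); referee ref-4.  THE TWIN'S DOCUMENTATION FOLLOWS
VERBATIM (its «levels 1 … k» / «Ω₁ = X» sentences describe the twin; here `j` runs from `0` and `Ω₁` may be a proper subset).

# `Balaban1983to89.B6InDecayWindowV1` — T. Bałaban, *Propagators and renormalization transformations for lattice gauge theories. II*,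
# Commun. Math. Phys. **96** (1984) 223–250 [Balaban1984PropagatorsII], (2.133)–(2.134) p. 247 with p. 238 (*"we take the cube □̃³ and identify it
# with a torus T_□"*): INPUT- (and OUTPUT-) LOCALISED MAJORANTS **WITH GLOBAL DECAY** for operators of `T_□` transplanted through a FULL window —
# the band bridge «torus distance of `T_□` ≥ κ·(flat distance)» for pairs with one end in the middle band of the window

statement-level skeleton of published theorems with citation tags; proofs where landed; nothing here is a claim about the Yang–Mills mass gap

PDF held: `paper:balaban1984-cmp96-propagators-rt-ii` (journal page = PDF page + 222): p. 238 [PDF 16] (□ ⊂ □̃ ⊂ □̃² ⊂ □̃³ = T_□: the operators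
`G_□` of (2.90) live on the torus `T_□`, their INPUTS `h_□J` are central), p. 247 [PDF 25] ((2.133): *"|(G_□J)(x)|, |(∇G_□J)(x)| ≤ O(1)[(L^jη)², L^jη]
e^{−δ₂|y−y′|}|J| for x ∈ Δ(y), supp J ⊂ Δ(y′), y, y′ ∈ 𝔅 ∩ T_□"*; (2.134) reads `G_□′h_□′J` at ARBITRARY outputs).

CITATION HEADER (lean-in-tree rule) — WHAT IS REPRODUCED.  Phase-2 file of the `lit-balaban` typed skeleton (HOME `run/shared/lean/pub/lit-balaban/`),
seat **r03 gen 21** (row owner of B6.Prop2.6); SKELETON rows **B6.Eq2.133** × **B6.Eq2.134** × B6.Prop2.6 (cells).  Owner's finding F4 (B6-CLOSURE §5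
item 14) and p38 g27's answer (seat INBOX 2026-08-23T06:13:15Z): the (2.134) consumer `…B6Ineq2134KFamKLevelTorusL0.h2134_kFam_torus` needs, for the
window members `G_□`, `∇G_□`, `Q*a_□Q`, `∂P_□∂*` of the cubes, majorants with INPUTS over the central reach `T_□ ⊃ supp h_□`, OUTPUTS ANYWHERE, and DECAY
in the GLOBAL multiscale distance `d` — while a transplanted torus member only decays in the torus distance of `T_□`, which vanishes at wrap-around
pairs.  THIS FILE proves the bridge: if the input sits in the MIDDLE BAND of the window (torus labels `q₁` with `(C+1)(q₁+1) ≥ M`, `(C+1)q₁ ≤ C·M`,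
`M` the label period), then for EVERY output label `q` of the window `|q − q₁| ≤ C·|q − q₁|_{T_□}` (§2), hence the flat sup-distance of the points is
`≤ L^j·C·|y − y₁|_{T_□} + (L^j − 1)` (§3), hence the global distance `d(y(x), y(x₁)) ≤ C(d+1)·|·|_{T_□} + 2(d+1)` and the member's `A·e^{−δ|·|_T}`
is `≤ A·e^{2δ/C}·e^{−(δ/(C(d+1)))·d}` (§4: `inMajorant_transplant_of_band`, and the output-localised twin `outMajorant_transplant_of_band` for the
notion **`OutMajorant`** of §1); §5 fires both on the V1 global torus `T_η` (p21's `TDomains`/`geomT`, r03's full bond window `cB t x₀`):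
**`inDecay_window_V1`**, **`outDecay_window_V1`** — for ANY member operator `T′` with a (2.133)-shape majorant on `T_□` (p22/p38's `ineq2133_G`,
`ineq2133_DG`, `ineq2133_DlaG`, `ineq2133_QaQ`, `ineq288_twoScale` all have this shape).
No new definition of mathematical content beyond `OutMajorant`; no new fact; standard axioms.

HONEST SCOPE / DIVERGENCES. (1) Print centres `T_□ = □̃³` at the cube, so there `|·|_{T_□} ≥ ⅓·(flat)` for central inputs; our windows are anchored at
a corner (`B6CubeWindowV1`: the cube centre sits at the quarter point), and the band condition then holds for the reach `□⁺` only when `L ≥ 5` (file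
`B6CubeInDecayV1`); the lemmas here are corner-agnostic. (2) The factor `C` in the rate (`δ ↦ δ/(C(d+1))`) is ours (print: `δ₂ ↦ ½δ₂`). (3) Bookkeeping
only; NOT summit progress.  Unit `lit-balaban-r03` (gen 21), 2026-08-23.
-/

noncomputable section

open scoped BigOperators
open Finset

namespace Literature.MathematicalPhysics.QuantumFieldTheory.Balaban1983to89.B6InDecayWindowV1L0

open B6RandomWalk (HasMajorant BlockSupp blockPiece sum_blockPiece blockSupp_blockPiece)
open B6Prop26Gluing (LocalMajorant)
open B6Prop26ReachTransplant (restrictOp transplant restrictOp_apply transplant_apply restrictOp_apply_of_injOn restrictOp_apply_of_not_mem siteOfInt chartBond chartBond_src InWindow injOn_chartBond_full val_siteOfInt rep_iterBlockOf_siteOfInt sitesPerDir_zero sitesPerDir_j expKernel_le_of_dist_le)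
open B6InMajorantTransplant (InMajorant inMajorant_transplant)
open B4TorusKernel.MultiPeriod (circAbs circAbs_nonneg circAbs_of_centred circAbs_add_mul torusSupNorm)
open B4ContourShift (supNorm abs_le_supNorm supNorm_nonneg)
open Literature.MathematicalPhysics.QuantumFieldTheory.Balaban1983to89.B6InDecayWindowV1 (OutMajorant outMajorant_of_hasMajorant OutMajorant.localMajorant outMajorant_mono outMajorant_smul outMajorant_congr_set outMajorant_subset inMajorant_smul_of_le_on outMajorant_smul_of_le_on transplant_apply_of_not_mem abs_sub_le_mul_circAbs supNorm_sub_le_tdist_band outMajorant_transplant rel_window supNorm_div_le_of_band_right supNorm_div_le_of_band_left expKernel_of_supNorm_le inMajorant_transplant_of_band outMajorant_transplant_of_band injOn_posV_dir inWindow_of_mem_W)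

/-! ## §1  Output-localised majorants (the transposed companion of `InMajorant`) -/

section Out

variable {g : B6.Geometry} {X : Type}

end Out

/-! ## §2  The band arithmetic on one circle `ℤ/M`: for a label `q₁` of the middle band, `|q − q₁| ≤ C·|q − q₁|_{ℤ/M}` for EVERY label `q` -/

section Band

/-- off the centred range the circular distance is `M − |x|` (`|x| < M < 2|x|`). [folklore] -/
private theorem circAbs_eq_sub_of_large {M : ℕ} (hM : 1 ≤ M) {x : ℤ} (hxM : |x| < M) (hx : (M : ℤ) < 2 * |x|) : circAbs M x = M - |x| := by
  rcases le_or_gt 0 x with h0 | h0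
  · rw [abs_of_nonneg h0] at hxM hx ⊢
    have e : x = (x - M) + M * 1 := by ring
    rw [e, circAbs_add_mul, circAbs_of_centred hM (by rw [abs_of_nonpos (by linarith)]; linarith), abs_of_nonpos (by linarith)]
    ring
  · rw [abs_of_neg h0] at hxM hx ⊢
    have e : x = (x + M) + M * (-1) := by ring
    rw [e, circAbs_add_mul, circAbs_of_centred hM (by rw [abs_of_nonneg (by linarith)]; linarith), abs_of_nonneg (by linarith)]
    ring

end Band

/-! ## §3  On the member torus `T_□`: the flat sup-distance of two window points against the torus distance of their `j`-blocks, the input point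
in the middle band, the output point ANYWHERE in the fundamental domain -/

section LocalTorus

open B5Eq118OneStroke (iterBlockOf)
open B6LowerBound2153Torus (rep)
open B5Eq117TorusCarriers (Mk)
open B6Prop25TwoScaleCensus (TSIdx)

variable {d L : ℕ} {hd : 1 ≤ d + 1} {hL : Odd L ∧ 1 < L} {a₀ a₁ : ℝ} (i : TSIdx d L hd hL a₀ a₁)

/-- floor division by `n > 0` is `n`-Lipschitz up to the remainder: `|a − b| ≤ n·|⌊a/n⌋ − ⌊b/n⌋| + (n − 1)`. [folklore] -/
private theorem abs_sub_le_mul_abs_ediv_sub (n : ℤ) (hn : 0 < n) (a b : ℤ) : |a - b| ≤ n * |a / n - b / n| + (n - 1) := by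
  have ha := Int.emod_def a n
  have hb := Int.emod_def b n
  have hra0 := Int.emod_nonneg a hn.ne'
  have hrb0 := Int.emod_nonneg b hn.ne'
  have hra := Int.emod_lt_of_pos a hn
  have hrb := Int.emod_lt_of_pos b hn
  have hsplit : a - b = n * (a / n - b / n) + (a % n - b % n) := by
    rw [mul_sub]
    linarith
  have hr : |a % n - b % n| ≤ n - 1 := by
    rw [abs_le]
    constructor <;> linarith
  calc |a - b| = |n * (a / n - b / n) + (a % n - b % n)| := by rw [hsplit]
    _ ≤ |n * (a / n - b / n)| + |a % n - b % n| := abs_add_le _ _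
    _ ≤ n * |a / n - b / n| + (n - 1) := by
        rw [abs_mul, abs_of_pos hn]
        linarith

/-- labels of points of the fundamental domain lie in `[0, M_j)`, `M_j = 2L^{m+K−j}` the label period: `0 ≤ ⌊z/L^j⌋ < M_j` for `0 ≤ z < 2L^{m+K}`. [folklore] -/
private theorem ediv_period {z : ℤ} (hz0 : 0 ≤ z) (hzN : z < (i.P.sitesPerDir 0 : ℕ)) :
    0 ≤ z / ((L ^ i.j : ℕ) : ℤ) ∧ z / ((L ^ i.j : ℕ) : ℤ) < ((i.P.sitesPerDir i.j : ℕ) : ℤ) := by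
  have hL0 : 0 < L := by have := hL.2; omega
  have hn : (0 : ℤ) < ((L ^ i.j : ℕ) : ℤ) := by positivity
  refine ⟨Int.ediv_nonneg hz0 hn.le, Int.ediv_lt_of_lt_mul hn ?_⟩
  have hpow : ((i.P.sitesPerDir 0 : ℕ) : ℤ) = ((i.P.sitesPerDir i.j : ℕ) : ℤ) * ((L ^ i.j : ℕ) : ℤ) := by
    rw [sitesPerDir_zero, sitesPerDir_j, ← Nat.cast_mul, mul_assoc, ← pow_add, Nat.sub_add_cancel (Nat.le_of_succ_le i.hjP)]
  rw [← hpow]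
  exact hzN

end LocalTorus

/-! ## §4  The generic bridges: a member operator with a (2.133)-shape majorant on `T_□`, transplanted through a window chart (possibly the full
fundamental domain), has an INPUT-localised (resp. OUTPUT-localised) majorant with GLOBAL decay when the inputs (resp. outputs) sit in the band -/

section Bridge

open B5Eq118OneStroke (iterBlockOf)
open B6Prop25TwoScaleCensus (TSIdx)
open B6Ineq2133TwoScaleV1 (tsGeo tsGeo_dist_comm)

variable {X X' : Type}

variable {d L : ℕ} {hd : 1 ≤ d + 1} {hL : Odd L ∧ 1 < L} {a₀ a₁ : ℝ} (i : TSIdx d L hd hL a₀ a₁)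

/-- the sup norm is even. [folklore] -/
private theorem supNorm_neg (x : Fin (d + 1) → ℤ) : supNorm (-x) = supNorm x := by
  unfold B4ContourShift.supNorm
  congr 1
  funext μ
  simp

end Bridge

/-! ## §5  FIRED ON THE V1 GLOBAL TORUS `T_η` (p21's torus family `D`, geometry `geomT D`, block map `blkV1`; r03's full bond window `cB t x₀`):
a member operator with a (2.133)-shape majorant on `T_□`, transplanted through the FULL window, has input- and output-localised majorants with global decay
over any reach whose bonds sit in the middle band of the window -/

section V1

open B5Eq118OneStroke (iterBlockOf)
open B6LowerBound2153Torus (rep)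
open B5Eq117TorusCarriers (Mk)
open B6Prop25TwoScaleCensus (TSIdx)
open B6Ineq2133TwoScaleV1 (tsGeo)
open B6GlobalChartV1 (PV toBox toBox_apply)
open B6GlobalChartV1L0 (blkV1)
open B6MultiLevelBoxOperator (N0)
open B6MultiLevelBoxOperatorL0 (Domains)
open B6MultiLevelTorusOperatorL0 (TDomains)
open B6Geom246MultiLevelBoxL0 (bset blkOf geom bond coord_bounds lev_eq_of_blkOf_eq)
open B6Geom246MultiLevelTorusL0 (geomT bondT distT_le_dist_box)
open B4Reflection242 (boxDom)
open B6AgreeLapV1Chart (cB eB posV mem_cB_W transplant_eB_eq)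
open B6Prop26ReachTransplantL0 (hglob_sites)

variable {d ℓ : ℕ} {hd : 1 ≤ d + 1} {hL : Odd (ℓ + 1) ∧ 1 < ℓ + 1} {a₀ a₁ : ℝ} {m K : ℕ} (t : TSIdx d (ℓ + 1) hd hL a₀ a₁)

/-- a site of `T^{(j)}` is determined by its labels. [folklore] -/
private theorem rep_injective : Function.Injective (rep (Mk t.P t.j) : Site t.P t.j → Fin (d + 1) → ℤ) := by
  intro y y' h
  funext μ
  have hμ := congrFun h μ
  simp only [rep, Nat.cast_inj] at hμ
  exact ZMod.val_injective _ hμ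

/-- **THE FIBRE INPUT FOR A WINDOW UP TO THE FULL PERIOD**: `≤ L^{d+1}` charted `j`-blocks over a global block of level `j` or `j + 1` meeting the
window (corner in `L^jℤ^{d+1}`; `B6Prop26ReachTransplantL0.hfib_sites` with the side bound relaxed from the half to the full fine period of `T_□`).
[cite: Balaban1984PropagatorsII, (2.1) p.224, (2.89) p.239, p.238 (T_□ = □̃³); Balaban1984PropagatorsI, (1.16)–(1.18) p.20] -/
theorem hfib_sites_full {Mh k R : ℕ} {P : Fin (d + 1) → ℕ} (D : B6MultiLevelBoxOperatorL0.Domains d ℓ Mh k P R) {X : Type}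
    (site : X → ↥(boxDom (N0 ℓ Mh k P))) (dir : X → Fin (d + 1)) (x₀ : Fin (d + 1) → ℤ)
    (hx₀ : ∀ μ, (((ℓ + 1) ^ t.j : ℕ) : ℤ) ∣ x₀ μ) (Wd : ℕ) (hWd : Wd ≤ t.P.sitesPerDir 0)
    (hlev : ∀ z ∈ boxDom (N0 ℓ Mh k P), (∀ μ, x₀ μ ≤ z μ ∧ z μ < x₀ μ + Wd) → t.j ≤ D.lev z ∧ D.lev z ≤ t.j + 1)
    (W : Finset X) (hW : ∀ x ∈ W, InWindow (fun x => (site x : Fin (d + 1) → ℤ)) x₀ Wd x) (y : ↥(bset D)) :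
    ∃ T : Finset (Site t.P t.j), T.card ≤ (ℓ + 1) ^ (d + 1) ∧ ∀ x ∈ W, blkOf D (site x) = y → iterBlockOf t.j
      (chartBond t (fun x => (site x : Fin (d + 1) → ℤ)) dir x₀ x).src ∈ T := by
  classical
  set F := (W.filter (fun x => blkOf D (site x) = y)).image (fun x => iterBlockOf t.j
      (chartBond t (fun x => (site x : Fin (d + 1) → ℤ)) dir x₀ x).src) with hF
  have hmemF : ∀ x ∈ W, blkOf D (site x) = y → iterBlockOf t.j
      (chartBond t (fun x => (site x : Fin (d + 1) → ℤ)) dir x₀ x).src ∈ F := fun x hx hxy =>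
    Finset.mem_image.mpr ⟨x, Finset.mem_filter.mpr ⟨hx, hxy⟩, rfl⟩
  refine ⟨F, ?_, hmemF⟩
  by_cases hne : (W.filter (fun x => blkOf D (site x) = y)) = ∅
  · rw [hF, hne, Finset.image_empty, Finset.card_empty]
    exact Nat.zero_le _
  obtain ⟨b₀, hb₀⟩ := Finset.nonempty_iff_ne_empty.mpr hne
  obtain ⟨hb₀W, hb₀y⟩ := Finset.mem_filter.mp hb₀
  set tl := y.1.1 with ht
  have hwin₀ := hW b₀ hb₀W
  have htlev : D.lev (site b₀ : Fin (d + 1) → ℤ) = tl := lev_eq_of_blkOf_eq D hb₀y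
  have ht_range : t.j ≤ tl ∧ tl ≤ t.j + 1 := by
    rw [← htlev]
    exact hlev _ (site b₀).2 hwin₀
  have hL1 : 1 ≤ ℓ + 1 := by omega
  have hLpos : (0 : ℤ) < (((ℓ + 1) ^ t.j : ℕ) : ℤ) := by positivity
  have hdvd : ∀ μ, (((ℓ + 1) ^ t.j : ℕ) : ℤ) ∣ (((ℓ + 1) ^ tl : ℕ) : ℤ) * y.1.2 μ - x₀ μ := fun μ =>
    dvd_sub (dvd_mul_of_dvd_left (by exact_mod_cast pow_dvd_pow (ℓ + 1) ht_range.1) _) (hx₀ μ)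
  set a : Fin (d + 1) → ℤ := fun μ => ((((ℓ + 1) ^ tl : ℕ) : ℤ) * y.1.2 μ - x₀ μ) / (((ℓ + 1) ^ t.j : ℕ) : ℤ) with ha
  set B : Finset (Fin (d + 1) → ℤ) := Fintype.piFinset fun μ => Finset.Ico (a μ) (a μ + (ℓ + 1 : ℕ)) with hB
  have hBcard : B.card = (ℓ + 1) ^ (d + 1) := by
    rw [hB, Fintype.card_piFinset]
    simp only [Int.card_Ico, add_sub_cancel_left, Int.toNat_natCast, Finset.prod_const, Finset.card_univ,
      Fintype.card_fin]
  have hinto : ∀ s ∈ F, rep (Mk t.P t.j) s ∈ B := by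
    intro s hs
    obtain ⟨b, hb, rfl⟩ := Finset.mem_image.mp hs
    obtain ⟨hbW, hby⟩ := Finset.mem_filter.mp hb
    have hwin := hW b hbW
    have hz0 : ∀ μ, 0 ≤ (site b : Fin (d + 1) → ℤ) μ - x₀ μ := fun μ => by have := (hwin μ).1; linarith
    have hzN : ∀ μ, (site b : Fin (d + 1) → ℤ) μ - x₀ μ < (t.P.sitesPerDir 0 : ℕ) := fun μ => by
      have := (hwin μ).2
      have hc : ((Wd : ℕ) : ℤ) ≤ ((t.P.sitesPerDir 0 : ℕ) : ℤ) := by exact_mod_cast hWd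
      linarith
    rw [hB, Fintype.mem_piFinset]
    intro μ
    rw [Finset.mem_Ico, chartBond_src, rep_iterBlockOf_siteOfInt t hz0 hzN μ]
    obtain ⟨hlo, hhi⟩ := coord_bounds D hby μ
    have hlo' : (((ℓ + 1) ^ tl : ℕ) : ℤ) * y.1.2 μ - x₀ μ ≤ (site b : Fin (d + 1) → ℤ) μ - x₀ μ := by
      have : (((ℓ + 1) ^ y.1.1 : ℕ) : ℤ) = (((ℓ + 1) ^ tl : ℕ) : ℤ) := by rw [ht]
      linarith
    constructor
    · exact Int.ediv_le_ediv hLpos hlo'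
    · refine Int.ediv_lt_of_lt_mul hLpos ?_
      have hmul : a μ * (((ℓ + 1) ^ t.j : ℕ) : ℤ) = (((ℓ + 1) ^ tl : ℕ) : ℤ) * y.1.2 μ - x₀ μ :=
        Int.ediv_mul_cancel (hdvd μ)
      have hpow : (((ℓ + 1) ^ tl : ℕ) : ℤ) ≤ ((ℓ + 1 : ℕ) : ℤ) * (((ℓ + 1) ^ t.j : ℕ) : ℤ) := by
        rw [← Nat.cast_mul, ← pow_succ']
        exact_mod_cast Nat.pow_le_pow_right hL1 ht_range.2
      have hhi' : (site b : Fin (d + 1) → ℤ) μ < (((ℓ + 1) ^ tl : ℕ) : ℤ) * y.1.2 μ + (((ℓ + 1) ^ tl : ℕ) : ℤ) := by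
        have : (((ℓ + 1) ^ y.1.1 : ℕ) : ℤ) = (((ℓ + 1) ^ tl : ℕ) : ℤ) := by rw [ht]
        linarith
      nlinarith
  calc F.card ≤ B.card := Finset.card_le_card_of_injOn (rep (Mk t.P t.j)) hinto ((rep_injective t).injOn)
    _ = (ℓ + 1) ^ (d + 1) := hBcard

variable {t}
variable {x₀ : Fin (d + 1) → ℤ} {hx₀ : ∀ μ, 0 ≤ x₀ μ} {hfit : ∀ μ, x₀ μ + (t.P.sitesPerDir 0 : ℕ) ≤ ((PV d ℓ m K hd hL).sitesPerDir 0 : ℕ)}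

variable {Mh k R : ℕ} {P' : Fin (d + 1) → ℕ} (hN : ∀ μ, N0 ℓ Mh k P' μ = (PV d ℓ m K hd hL).sitesPerDir 0) (D : TDomains d ℓ Mh k P' R)

/-- the distance input on the full window: `d_T(y(b), y(b₁)) ≤ (d+1)·|b₋ − b₁₋|_∞/L^j + (d+1)` when every window site has level `≥ j`.
[cite: Balaban1984PropagatorsII, p.232 (before (2.53)), (2.46) p.231] -/
theorem hglob_W (hMh : 1 ≤ Mh) (hP : ∀ μ, 1 ≤ P' μ)
    (hlev : ∀ z ∈ boxDom (N0 ℓ Mh k P'), (∀ μ, x₀ μ ≤ z μ ∧ z μ < x₀ μ + (t.P.sitesPerDir 0 : ℕ)) → t.j ≤ D.lev z) :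
    ∀ b ∈ (cB t x₀ hx₀ hfit).W, ∀ b₁ ∈ (cB t x₀ hx₀ hfit).W,
      (B6Geom246MultiLevelTorusL0.geomT D).dist (blkV1 hN D b) (blkV1 hN D b₁) ≤ (d + 1 : ℝ) * (supNorm (posV b - posV b₁) / (((ℓ + 1) ^ t.j : ℕ) : ℝ)) + (d + 1 : ℝ) := by
  intro b hb b₁ hb₁
  have hbox := hglob_sites t D.toDomains hMh hP (fun b : PBond (PV d ℓ m K hd hL) 0 => toBox hN b.src) x₀ (t.P.sitesPerDir 0) hlev
    (cB t x₀ hx₀ hfit).W (fun b hb => inWindow_of_mem_W hb) Set.univ b hb b₁ hb₁ (Set.mem_univ _) (Set.mem_univ _)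
  have hT : (((bondT D).dist (blkV1 hN D b) (blkV1 hN D b₁) : ℕ) : ℝ)
      ≤ (((bond D.toDomains).dist (blkV1 hN D b) (blkV1 hN D b₁) : ℕ) : ℝ) := by
    exact_mod_cast distT_le_dist_box (D := D) hMh hP _ _
  exact hT.trans hbox

/-- **THE BAND BRIDGE ON `T_η`, INPUT-LOCALISED FORM**: for a member operator `T′` with the (2.133)-shape majorant `A·e^{−δ|y−y′|_{T_□}}`
(`ineq2133_G`/`_DG`/`_DlaG`/`_QaQ`/`ineq288_twoScale` …), a corner `x₀ ≥ 0` with the full member period inside the box, `L^j ∣ x₀`, the full window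
two-level (`j`, `j+1`), and a reach `S` all of whose window bonds have labels in the middle band (`C ≥ 1`): the full-window transplant `ε T′ ρ` has
`InMajorant (blkV1 hN D) (ε T′ ρ) S (L^{d+1}·A·e^{2δ/C}·e^{−(δ/((d+1)C))·d_T})` — inputs over `S`, outputs ANYWHERE.
[cite: Balaban1984PropagatorsII, (2.133)–(2.134) p.247, (2.90)–(2.91) p.239, p.238 (T_□ = □̃³)] -/
theorem inDecay_window_V1 {T' : Module.End ℝ (PBond t.P 0 → ℝ)} {A δ : ℝ} (hA : 0 ≤ A) (hδ : 0 ≤ δ)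
    (hT' : HasMajorant (g := tsGeo t 0 0) (fun b : PBond t.P 0 => iterBlockOf t.j b.src) T' (fun y y' => A * Real.exp (-(δ * t.tdist y y'))))
    (hMh : 1 ≤ Mh) (hP : ∀ μ, 1 ≤ P' μ) (hdiv : ∀ μ, (((ℓ + 1) ^ t.j : ℕ) : ℤ) ∣ x₀ μ)
    (hlev : ∀ z ∈ boxDom (N0 ℓ Mh k P'), (∀ μ, x₀ μ ≤ z μ ∧ z μ < x₀ μ + (t.P.sitesPerDir 0 : ℕ)) → t.j ≤ D.lev z ∧ D.lev z ≤ t.j + 1)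
    {C : ℕ} (hC : 1 ≤ C) (S : Set (B6Geom246MultiLevelTorusL0.geomT D).Site)
    (hband : ∀ b ∈ (cB t x₀ hx₀ hfit).W, blkV1 hN D b ∈ S → ∀ μ,
      ((t.P.sitesPerDir t.j : ℕ) : ℤ) ≤ (C + 1) * ((posV b μ - x₀ μ) / (((ℓ + 1) ^ t.j : ℕ) : ℤ) + 1) ∧
        ((C : ℤ) + 1) * ((posV b μ - x₀ μ) / (((ℓ + 1) ^ t.j : ℕ) : ℤ)) ≤ C * ((t.P.sitesPerDir t.j : ℕ) : ℤ)) :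
    InMajorant (g := geomT D) (blkV1 hN D) (transplant (cB t x₀ hx₀ hfit).W (eB t x₀) T') S
      (fun a b => ((ℓ + 1) ^ (d + 1) : ℕ) * ((A * Real.exp (δ * ((d + 1 : ℝ) + (d + 1)) / ((d + 1) * C))) *
        Real.exp (-(δ / ((d + 1) * C) * (geomT D).dist a b)))) := by
  classical
  rw [transplant_eB_eq]
  exact inMajorant_transplant_of_band t 0 0 (g := geomT D) (blkV1 hN D) S posV PBond.dir x₀ le_rfl (cB t x₀ hx₀ hfit).W
    (fun b hb => inWindow_of_mem_W hb) (injOn_posV_dir _) hA hδ hT' hC hband (d + 1) (d + 1) (by positivity)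
    (hglob_W hN D hMh hP fun z hz hw => (hlev z hz hw).1) ((ℓ + 1) ^ (d + 1))
    (fun y _ => hfib_sites_full t D.toDomains (fun b : PBond (PV d ℓ m K hd hL) 0 => toBox hN b.src) PBond.dir x₀ hdiv _ le_rfl hlev _
      (fun b hb => inWindow_of_mem_W hb) y)

/-- **THE BAND BRIDGE ON `T_η`, OUTPUT-LOCALISED FORM**: the same with the OUTPUT bonds over `S` in the band, inputs ANYWHERE.
[cite: Balaban1984PropagatorsII, (2.133)–(2.134) p.247, (2.90)–(2.91) p.239, p.238 (T_□ = □̃³)] -/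
theorem outDecay_window_V1 {T' : Module.End ℝ (PBond t.P 0 → ℝ)} {A δ : ℝ} (hA : 0 ≤ A) (hδ : 0 ≤ δ)
    (hT' : HasMajorant (g := tsGeo t 0 0) (fun b : PBond t.P 0 => iterBlockOf t.j b.src) T' (fun y y' => A * Real.exp (-(δ * t.tdist y y'))))
    (hMh : 1 ≤ Mh) (hP : ∀ μ, 1 ≤ P' μ) (hdiv : ∀ μ, (((ℓ + 1) ^ t.j : ℕ) : ℤ) ∣ x₀ μ)
    (hlev : ∀ z ∈ boxDom (N0 ℓ Mh k P'), (∀ μ, x₀ μ ≤ z μ ∧ z μ < x₀ μ + (t.P.sitesPerDir 0 : ℕ)) → t.j ≤ D.lev z ∧ D.lev z ≤ t.j + 1)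
    {C : ℕ} (hC : 1 ≤ C) (S : Set (B6Geom246MultiLevelTorusL0.geomT D).Site)
    (hband : ∀ b ∈ (cB t x₀ hx₀ hfit).W, blkV1 hN D b ∈ S → ∀ μ,
      ((t.P.sitesPerDir t.j : ℕ) : ℤ) ≤ (C + 1) * ((posV b μ - x₀ μ) / (((ℓ + 1) ^ t.j : ℕ) : ℤ) + 1) ∧
        ((C : ℤ) + 1) * ((posV b μ - x₀ μ) / (((ℓ + 1) ^ t.j : ℕ) : ℤ)) ≤ C * ((t.P.sitesPerDir t.j : ℕ) : ℤ)) :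
    OutMajorant (g := geomT D) (blkV1 hN D) (transplant (cB t x₀ hx₀ hfit).W (eB t x₀) T') S
      (fun a b => ((ℓ + 1) ^ (d + 1) : ℕ) * ((A * Real.exp (δ * ((d + 1 : ℝ) + (d + 1)) / ((d + 1) * C))) *
        Real.exp (-(δ / ((d + 1) * C) * (geomT D).dist a b)))) := by
  classical
  rw [transplant_eB_eq]
  exact outMajorant_transplant_of_band t 0 0 (g := geomT D) (blkV1 hN D) S posV PBond.dir x₀ le_rfl (cB t x₀ hx₀ hfit).W
    (fun b hb => inWindow_of_mem_W hb) (injOn_posV_dir _) hA hδ hT' hC hband (d + 1) (d + 1) (by positivity)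
    (hglob_W hN D hMh hP fun z hz hw => (hlev z hz hw).1) ((ℓ + 1) ^ (d + 1))
    (fun y => hfib_sites_full t D.toDomains (fun b : PBond (PV d ℓ m K hd hL) 0 => toBox hN b.src) PBond.dir x₀ hdiv _ le_rfl hlev _
      (fun b hb => inWindow_of_mem_W hb) y)

end V1

end Literature.MathematicalPhysics.QuantumFieldTheory.Balaban1983to89.B6InDecayWindowV1L0
end
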